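import Summits.ValiantsHypothesis.ValiantsHypothesis.Theorems.DepthWindowJumpPaths
import Summits.ValiantsHypothesis.ValiantsHypothesis.Theorems.DepthWindowIMMPaths
import HarnessLib

/-!
# Route `DepthWindow`, g8 — the two-level sparse formula for a truncated product (sliver, piece (ii))

Chains `Theorems/DepthWindowJumpPaths.lean` (the jump-indexed program:
`[∏_{l<t} U_l]_e = ∑_{k ≤ e} ∑_y (jumpMat^{×k})_{(0,0),y} · finVec y`) with the meet-in-the-middle
lemma `imm_apply_eq_sum_paths_blocks` of `Theorems/DepthWindowIMMPaths.lean`, after padding the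
`k` jump layers with identity layers to `a·b` layers (`padLayers`, `prod_ofFn_padLayers`):
`weightedHomogeneousComponent_prod_eq_twoLevel` is the explicit, layer-by-layer homogeneous
`Σ Π^{[a]} Σ Π^{[b]}` expression of `[∏_{l<t} U_l]_e` in weight-`0` scalars and single components
`[U_j]_ρ` (`1 ≤ ρ ≤ d`), of size `((d+1)(t+1))^{O(a+b)}` — with `a = b = ⌈√d⌉` the
`(d t)^{O(√d)}` bound of lens-4 NODE-v7 §6 (2) (the sliver regime `t ≤ 2^{O(d^{1.5})}`).
This completes the ALGEBRAIC side of the sparse sliver lemma; the remaining work is gate-level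
(realise the expression as `ArithCircuit` gates inside `HomRel`'s budget and merge the inner `Π`
with the product layer of the level below, NODE-v7 §6 (3)–(5)).  Nothing here bears on `VP ≠ VNP`.

[cite: LimayeSrinivasanTavenas2025, Lemma 11]
-/

set_option linter.dupNamespace false

namespace Summit.ValiantsHypothesis.ValiantsHypothesis.Theorems.DepthWindow

open MvPolynomial Finset

/-! ### Two-level (meet-in-the-middle) form of the sparse expansion -/

section TwoLevel

variable {n : Type*} [Fintype n] [DecidableEq n] {α : Type*} [Semiring α]

/-- Padding `k` copies of a matrix `N` with identity layers to a prescribed number of layers. -/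
def padLayers (N : Matrix n n α) (k len : ℕ) : Fin len → Matrix n n α :=
  fun l => if (l : ℕ) < k then N else 1

/-- The padded iterated product is `N ^ min k len`. -/
theorem prod_ofFn_padLayers (N : Matrix n n α) (k : ℕ) :
    ∀ len : ℕ, (List.ofFn (padLayers N k len)).prod = N ^ min k len
  | 0 => by simp
  | len + 1 => by
      rw [List.ofFn_succ', List.prod_concat]
      have h : (List.ofFn fun i : Fin len => padLayers N k (len + 1) i.castSucc) =
          List.ofFn (padLayers N k len) := by
        exact List.ofFn_inj.mpr (funext fun i => rfl)
      rw [h, prod_ofFn_padLayers N k len]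
      simp only [padLayers, Fin.val_last]
      by_cases hk : len < k
      · rw [if_pos hk, min_eq_right (le_of_lt hk), min_eq_right hk, pow_succ]
      · rw [if_neg hk, mul_one, min_eq_left (not_lt.mp hk),
          min_eq_left ((not_lt.mp hk).trans (Nat.le_succ _))]

/-- With `k ≤ len` identity-padded layers, the iterated product is `N^{×k}`. -/
theorem prod_ofFn_padLayers_of_le (N : Matrix n n α) {k len : ℕ} (h : k ≤ len) :
    (List.ofFn (padLayers N k len)).prod = (List.ofFn fun _ : Fin k => N).prod := by
  rw [prod_ofFn_padLayers, min_eq_left h, List.ofFn_const, List.prod_replicate]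

end TwoLevel

section TwoLevelSparse

variable {σ R : Type*} [CommSemiring R]

/-- **The two-level sparse formula (NODE-v7 §6 (1)–(2), sparse form).**  For `e ≤ d` and block
parameters `a, b` with `e ≤ a·b` (take `a = b = ⌈√e⌉`): the weight-`e` component of `∏_{l<t} U_l`
is `∑_{k ≤ e} ∑_y [two-level path sum of the k-jump program, padded to a·b layers]_{(0,0),y} · finVec y`,
where the two-level path sum ranges over outer state tuples `S : Fin (a+1) → states` (a `Σ` of
fan-in `((d+1)(t+1))^{a+1}`, then a `Π` of fan-in `a`) of inner path sums over
`s : Fin (b+1) → states` (a `Σ` of fan-in `((d+1)(t+1))^{b+1}`, then a `Π` of fan-in `b` of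
jump-matrix entries = weight-`0` scalars times single components `[U_j]_ρ`, or identity entries).
Every `Σ` here adds terms of equal weight, so the formula is homogeneous layer by layer; its size
is `((d+1)(t+1))^{O(a+b)} = (d t)^{O(√d)}`. [cite: LimayeSrinivasanTavenas2025, Lemma 11] -/
theorem weightedHomogeneousComponent_prod_eq_twoLevel (w : σ → ℕ) (d t e a b : ℕ) (he : e ≤ d)
    (hab : e ≤ a * b) (U : ℕ → MvPolynomial σ R) :
    weightedHomogeneousComponent w e (∏ l ∈ range t, U l) =
      ∑ k ∈ range (e + 1), ∑ y : Fin (d + 1) × Fin (t + 1),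
        (∑ S : Fin (a + 1) → Fin (d + 1) × Fin (t + 1),
          (if S 0 = ((0 : Fin (d + 1)), (0 : Fin (t + 1))) then 1 else 0) *
            (∏ q : Fin a, ∑ s : Fin (b + 1) → Fin (d + 1) × Fin (t + 1),
              (if s 0 = S q.castSucc then 1 else 0) *
                pathWeight (fun u : Fin b =>
                  padLayers (jumpMat w d t U) k (a * b) ⟨(q : ℕ) * b + u, blockIndex_lt q u⟩) s *
                (if s (Fin.last b) = S q.succ then 1 else 0)) *
            (if S (Fin.last a) = y then 1 else 0)) *
          finVec w d t e U y := by
  rw [weightedHomogeneousComponent_prod_eq_sum_imm w d t e he U]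
  refine Finset.sum_congr rfl fun k hk => Finset.sum_congr rfl fun y _ => ?_
  rw [Finset.mem_range] at hk
  rw [← prod_ofFn_padLayers_of_le (jumpMat w d t U) (show k ≤ a * b by omega),
    imm_apply_eq_sum_paths_blocks]

end TwoLevelSparse

end Summit.ValiantsHypothesis.ValiantsHypothesis.Theorems.DepthWindow
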